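import Mathlib.Analysis.SpecialFunctions.ExpDeriv
import Mathlib.Analysis.SpecialFunctions.Pow.Real
import Mathlib.Algebra.MvPolynomial.Basic
import Mathlib.Data.Set.Card
import Literature.NumberTheory.Transcendental.SupportCountingMasser
import Literature.Analysis.Approximation.RealExponentialSumZerosProofs
import HarnessLib

/-!
# Dasgupta–Kakde 2024, Theorem 7.1 (real case) — proof

Discharge of the named fact `Literature.NumberTheory.Transcendental.DasguptaKakde2024_thm_7_1_real`
(`SupportCountingMasser.lean`): for a real `2 × 2` logarithm matrix `A = (aᵢ bⱼ)` of rank `≤ 1`,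
condition (m′) (for all large `N` a nonzero real polynomial with fewer than `N²` monomials vanishes
on the box image `X(2N)`) implies condition (o) (`∏ᵢⱼ x_{ij}^{a'ᵢ b'ⱼ} = 1` for some nonzero
`a', b' ∈ ℤ²`).

We follow the printed proof (S. Dasgupta, M. Kakde, arXiv:2408.08178, §7.1, p. 10): a polynomial
`P = Σ_w c_w t^w` vanishing on `X(2N)` gives the real exponential sum `f(z) = Σ_w c_w e^{(w·b) z}`
with fewer than `N²` terms and the `4N²` zeros `z = v·a`, `v ∈ [0, 2N)²`; "unless two of the
`w·a`'s are equal or two of the `v·b`'s are equal" (sic; i.e. unless `a` or `b` is `ℤ`-linearly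
dependent, which is exactly (o)), this contradicts Lemma 7.2 — a real exponential sum with `n`
terms is identically zero or has at most `n - 1` zeros, the tree's
`Literature.Analysis.Approximation.Braess1986_VI_1_1_proper` (now a theorem,
`Braess1986_VI_1_1_proper_holds`).  The case "identically zero" is excluded by the linear
independence of exponentials with distinct exponents (`DasguptaKakde2024.expSum_coeff_eq_zero`,
the same Rolle-free induction: differentiate `e^{-t₀ z} f`).

## References
* [DasguptaKakde2024] S. Dasgupta, M. Kakde, *Ranks of matrices of logarithms of algebraic numbers
  II*, arXiv:2408.08178, §7.1 Theorem 7.1 and Lemma 7.2.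
* [Braess1986] D. Braess, *Nonlinear Approximation Theory* (1986), Ch. VI §1 Lemma 1.1.
-/

namespace Literature.NumberTheory.Transcendental

section DasguptaKakde2024Proof

open Finset

/-- The derivative of a real exponential sum. [folklore] -/
private theorem DasguptaKakde2024.hasDerivAt_expSum {k : ℕ} (α s : Fin k → ℝ) (x : ℝ) :
    HasDerivAt (fun y => ∑ ν, α ν * Real.exp (s ν * y))
      (∑ ν, α ν * (Real.exp (s ν * x) * s ν)) x := by
  have h : ∀ ν ∈ (Finset.univ : Finset (Fin k)),
      HasDerivAt (fun y => α ν * Real.exp (s ν * y)) (α ν * (Real.exp (s ν * x) * s ν)) x := by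
    intro ν _
    have h1 : HasDerivAt (fun y => s ν * y) (s ν) x := by
      simpa using (hasDerivAt_id' x).const_mul (s ν)
    exact (h1.exp).const_mul (α ν)
  exact HasDerivAt.fun_sum h

/-- **Exponentials with distinct exponents are linearly independent**: if
`Σ_ν α_ν e^{t_ν x} = 0` for all real `x` and the `t_ν` are pairwise distinct, then all `α_ν = 0`.
(Induction on the number of terms: multiply by `e^{-t₀ x}` and differentiate.) [folklore] -/
private theorem DasguptaKakde2024.expSum_coeff_eq_zero :
    ∀ {k : ℕ} (α t : Fin k → ℝ), Function.Injective t →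
      (∀ x, ∑ ν, α ν * Real.exp (t ν * x) = 0) → ∀ ν, α ν = 0 := by
  intro k
  induction k with
  | zero => intro α t _ _ ν; exact ν.elim0
  | succ k ih =>
    intro α t ht h
    -- `v = e^{-t₀ x} u ≡ 0`
    set v : ℝ → ℝ := fun x => ∑ ν, α ν * Real.exp ((t ν - t 0) * x) with hv
    have key : ∀ (ν : Fin (k + 1)) (x : ℝ),
        Real.exp (t 0 * x) * Real.exp ((t ν - t 0) * x) = Real.exp (t ν * x) := by
      intro ν x
      rw [← Real.exp_add]
      congr 1
      ring
    have hv0 : ∀ x, v x = 0 := by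
      intro x
      have hu := h x
      have e : ∑ ν, α ν * Real.exp (t ν * x) = Real.exp (t 0 * x) * v x := by
        simp only [hv, Finset.mul_sum]
        refine Finset.sum_congr rfl fun ν _ => ?_
        symm
        rw [mul_left_comm, key]
      rw [e] at hu
      rcases mul_eq_zero.mp hu with h0 | h0
      · exact absurd h0 (Real.exp_ne_zero _)
      · exact h0
    -- its derivative, an exponential sum with `k` terms and distinct exponents, vanishes too
    have hvw : ∀ x, HasDerivAt v
        (∑ ν : Fin k, (α ν.succ * (t ν.succ - t 0)) * Real.exp ((t ν.succ - t 0) * x)) x := by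
      intro x
      refine (DasguptaKakde2024.hasDerivAt_expSum α (fun ν => t ν - t 0) x).congr_deriv ?_
      rw [Fin.sum_univ_succ]
      simp only [sub_self, mul_zero, zero_add]
      refine Finset.sum_congr rfl fun ν _ => ?_
      ring
    have hw0 : ∀ x, ∑ ν : Fin k, (α ν.succ * (t ν.succ - t 0)) * Real.exp ((t ν.succ - t 0) * x)
        = 0 := by
      intro x
      have hvconst : v = fun _ => (0 : ℝ) := funext hv0
      have h0 : HasDerivAt v 0 x := by
        rw [hvconst]
        exact hasDerivAt_const x 0
      exact (hvw x).unique h0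
    have hinj : Function.Injective (fun ν : Fin k => t ν.succ - t 0) := by
      intro ν ν' hνν'
      have : t ν.succ = t ν'.succ := by simpa using hνν'
      exact Fin.succ_injective _ (ht this)
    have hβ := ih (fun ν => α ν.succ * (t ν.succ - t 0)) (fun ν => t ν.succ - t 0) hinj hw0
    have hsucc : ∀ ν : Fin k, α ν.succ = 0 := by
      intro ν
      have hne : t ν.succ - t 0 ≠ 0 := by
        intro h0
        exact Fin.succ_ne_zero ν (ht (sub_eq_zero.mp h0))
      have := hβ ν
      rcases mul_eq_zero.mp this with h | h
      · exact h
      · exact absurd h hne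
    have hzero : α 0 = 0 := by
      have hu := h 0
      rw [Fin.sum_univ_succ, Finset.sum_eq_zero (fun ν _ => by rw [hsucc ν, zero_mul]),
        add_zero] at hu
      simpa using hu
    intro ν
    exact Fin.cases hzero hsucc ν

/-- `∏ᵢ e^{cᵢ}^{nᵢ} = e^{Σ nᵢ cᵢ}`. [folklore] -/
private theorem DasguptaKakde2024.prod_exp_pow {ι : Type*} [Fintype ι] (c : ι → ℝ) (n : ι → ℕ) :
    ∏ i, Real.exp (c i) ^ (n i) = Real.exp (∑ i, (n i : ℝ) * c i) := by
  rw [Real.exp_sum]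
  exact Finset.prod_congr rfl fun i _ => (Real.exp_nat_mul (c i) (n i)).symm

/-- `∏ᵢ e^{cᵢ}^{mᵢ} = e^{Σ mᵢ cᵢ}` for integer exponents. [folklore] -/
private theorem DasguptaKakde2024.prod_exp_zpow {ι : Type*} [Fintype ι] (c : ι → ℝ) (m : ι → ℤ) :
    ∏ i, Real.exp (c i) ^ (m i) = Real.exp (∑ i, (m i : ℝ) * c i) := by
  rw [Real.exp_sum]
  refine Finset.prod_congr rfl fun i _ => ?_
  rw [← Real.rpow_intCast, ← Real.exp_mul, mul_comm]

/-- **Dasgupta–Kakde 2024, Theorem 7.1 (real case) — proved** (discharge of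
`DasguptaKakde2024_thm_7_1_real`), by the printed argument: the exponential sum
`Σ_w c_w e^{(w·b) z}` attached to a sparse vanishing polynomial has too many zeros `z = v·a` for
Braess 1986 VI.1.1 / Lemma 7.2 unless `a` or `b` is `ℤ`-linearly dependent.
[cite: DasguptaKakde2024, §7.1 Theorem 7.1 (real case) with Lemma 7.2, pp. 10 of arXiv:2408.08178; conditions (o), (m′) §5 p. 8 and §7.1 p. 10] -/
theorem DasguptaKakde2024_thm_7_1_real_holds : DasguptaKakde2024_thm_7_1_real := by
  intro a b hm
  classical
  -- (o) in additive form: it suffices that `a` or `b` be `ℤ`-linearly dependent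
  have reduce : ∀ c : Fin 2 → ℤ, c ≠ 0 →
      ((∑ i, (c i : ℝ) * a i) = 0 ∨ (∑ j, (c j : ℝ) * b j) = 0) →
      ∃ a' b' : Fin 2 → ℤ, a' ≠ 0 ∧ b' ≠ 0 ∧
        ∏ i, ∏ j, Real.exp (a i * b j) ^ (a' i * b' j) = 1 := by
    intro c hc hsum
    refine ⟨c, c, hc, hc, ?_⟩
    have e : ∏ i, ∏ j, Real.exp (a i * b j) ^ (c i * c j)
        = Real.exp ((∑ i, (c i : ℝ) * a i) * ∑ j, (c j : ℝ) * b j) := by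
      rw [Finset.sum_mul_sum, Real.exp_sum]
      refine Finset.prod_congr rfl fun i _ => ?_
      rw [Real.exp_sum]
      refine Finset.prod_congr rfl fun j _ => ?_
      rw [← Real.rpow_intCast, ← Real.exp_mul]
      congr 1
      push_cast
      ring
    rw [e, Real.exp_eq_one_iff]
    rcases hsum with h | h
    · rw [h, zero_mul]
    · rw [h, mul_zero]
  by_contra hcon
  have ha : ∀ c : Fin 2 → ℤ, (∑ i, (c i : ℝ) * a i) = 0 → c = 0 := by
    intro c hc
    by_contra hne
    exact hcon (reduce c hne (Or.inl hc))
  have hb : ∀ c : Fin 2 → ℤ, (∑ j, (c j : ℝ) * b j) = 0 → c = 0 := by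
    intro c hc
    by_contra hne
    exact hcon (reduce c hne (Or.inr hc))
  -- the sparse polynomial at `N = N₀`
  obtain ⟨N₀, hN₀⟩ := hm
  obtain ⟨P, hP0, hPcard, hPvan⟩ := hN₀ N₀ le_rfl
  set N := N₀ with hN
  -- enumerate the support and form the exponential sum `u(z) = Σ_w c_w e^{(w·b) z}`
  set k : ℕ := P.support.card with hk
  obtain ⟨e, -⟩ : ∃ _ : Fin k ≃ ↥P.support, True := ⟨P.support.equivFin.symm, trivial⟩
  obtain ⟨α, hα⟩ : ∃ α : Fin k → ℝ, ∀ ν, α ν = P.coeff (e ν : Fin 2 →₀ ℕ) := ⟨_, fun _ => rfl⟩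
  obtain ⟨t, ht⟩ : ∃ t : Fin k → ℝ, ∀ ν, t ν = ∑ j, (((e ν : Fin 2 →₀ ℕ) j : ℕ) : ℝ) * b j :=
    ⟨_, fun _ => rfl⟩
  -- the zeros `z_v = v·a`, `v ∈ [0, 2N)²`
  obtain ⟨z, hz⟩ : ∃ z : (Fin 2 → Fin (2 * N)) → ℝ, ∀ v, z v = ∑ i, ((v i : ℕ) : ℝ) * a i :=
    ⟨_, fun _ => rfl⟩
  have hzero : ∀ v : Fin 2 → Fin (2 * N), ∑ ν, α ν * Real.exp (t ν * z v) = 0 := by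
    intro v
    have hv : ∑ d ∈ P.support, P.coeff d * ∏ j, (∏ i, Real.exp (a i * b j) ^ (v i : ℕ)) ^ d j
        = 0 := by
      simpa only [MvPolynomial.eval_eq'] using hPvan (fun i => (v i : ℕ)) (fun i => (v i).isLt)
    -- each monomial value is an exponential
    have hmon : ∀ d : Fin 2 →₀ ℕ,
        ∏ j, (∏ i, Real.exp (a i * b j) ^ (v i : ℕ)) ^ d j
          = Real.exp ((∑ j, ((d j : ℕ) : ℝ) * b j) * z v) := by
      intro d
      have inner : ∀ j, ∏ i, Real.exp (a i * b j) ^ (v i : ℕ) = Real.exp (z v * b j) := by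
        intro j
        rw [DasguptaKakde2024.prod_exp_pow, hz v, Finset.sum_mul]
        congr 1
        refine Finset.sum_congr rfl fun i _ => ?_
        ring
      rw [Finset.prod_congr rfl fun j _ => by rw [inner j], DasguptaKakde2024.prod_exp_pow,
        Finset.sum_mul]
      congr 1
      refine Finset.sum_congr rfl fun j _ => ?_
      ring
    rw [Finset.sum_congr rfl fun d _ => by rw [hmon d]] at hv
    -- reindex the sum over the support by `Fin k`
    have hre : ∑ ν, P.coeff (e ν : Fin 2 →₀ ℕ) *
          Real.exp ((∑ j, (((e ν : Fin 2 →₀ ℕ) j : ℕ) : ℝ) * b j) * z v)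
        = ∑ d ∈ P.support, P.coeff d * Real.exp ((∑ j, ((d j : ℕ) : ℝ) * b j) * z v) := by
      rw [← Finset.sum_coe_sort P.support]
      exact e.sum_comp (fun d : ↥P.support =>
        P.coeff (d : Fin 2 →₀ ℕ) * Real.exp ((∑ j, (((d : Fin 2 →₀ ℕ) j : ℕ) : ℝ) * b j) * z v))
    simp only [hα, ht]
    rw [hre]
    exact hv
  -- the exponents are distinct (`b` is `ℤ`-independent) ...
  have htinj : Function.Injective t := by
    intro ν ν' hνν'
    have hc : (∑ j, ((((e ν : Fin 2 →₀ ℕ) j : ℤ) - ((e ν' : Fin 2 →₀ ℕ) j : ℤ) : ℤ) : ℝ) * b j)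
        = 0 := by
      have h0 : t ν - t ν' = 0 := sub_eq_zero.mpr hνν'
      rw [ht ν, ht ν', ← Finset.sum_sub_distrib] at h0
      rw [← h0]
      refine Finset.sum_congr rfl fun j _ => ?_
      push_cast
      ring
    have h0 := hb _ hc
    have hd : (e ν : Fin 2 →₀ ℕ) = (e ν' : Fin 2 →₀ ℕ) := by
      ext j
      have := congrFun h0 j
      simp only [Pi.zero_apply, sub_eq_zero, Nat.cast_inj] at this
      exact this
    exact e.injective (Subtype.ext hd)
  -- ... and the zeros are distinct (`a` is `ℤ`-independent)
  have hzinj : Function.Injective z := by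
    intro v v' hvv'
    have hc : (∑ i, ((((v i : ℕ) : ℤ) - ((v' i : ℕ) : ℤ) : ℤ) : ℝ) * a i) = 0 := by
      have h0 : z v - z v' = 0 := sub_eq_zero.mpr hvv'
      rw [hz v, hz v', ← Finset.sum_sub_distrib] at h0
      rw [← h0]
      refine Finset.sum_congr rfl fun i _ => ?_
      push_cast
      ring
    have h0 := ha _ hc
    funext i
    have := congrFun h0 i
    simp only [Pi.zero_apply, sub_eq_zero, Nat.cast_inj] at this
    exact Fin.ext this
  -- Braess / Lemma 7.2
  rcases Literature.Analysis.Approximation.Braess1986_VI_1_1_proper_holds k α t with hid | ⟨hfin, hcard⟩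
  · -- identically zero: impossible, the coefficients of `P` on its support are nonzero
    have hαz := DasguptaKakde2024.expSum_coeff_eq_zero α t htinj hid
    have hne : P.support.Nonempty := by
      rw [Finset.nonempty_iff_ne_empty, Ne, MvPolynomial.support_eq_empty]
      exact hP0
    have hkpos : 0 < k := by rw [hk]; exact Finset.card_pos.mpr hne
    have hν := hαz ⟨0, hkpos⟩
    rw [hα] at hν
    exact (MvPolynomial.mem_support_iff.mp (e ⟨0, hkpos⟩).2) hν
  · -- finitely many zeros: but the `(2N)²` points `z_v` are distinct zeros
    have hsub : Set.range z ⊆ {x | ∑ ν, α ν * Real.exp (t ν * x) = 0} := by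
      rintro _ ⟨v, rfl⟩
      exact hzero v
    have hle := Set.ncard_le_ncard hsub hfin
    rw [Set.ncard_range_of_injective hzinj, Nat.card_eq_fintype_card, Fintype.card_fun,
      Fintype.card_fin, Fintype.card_fin] at hle
    -- `(2N)^2 ≤ k - 1` and `k < N^2`
    have h1 : (2 * N) ^ 2 ≤ k - 1 := hle.trans hcard
    have h2 : k < N ^ 2 := hPcard
    have h3 : N ^ 2 ≤ (2 * N) ^ 2 := Nat.pow_le_pow_left (by omega) 2
    omega

end DasguptaKakde2024Proof

end Literature.NumberTheory.Transcendental
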